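import Literature.AlgebraicGeometry.Modules.TensorBraiding
import Mathlib.Algebra.Colimit.TensorProduct
import Mathlib.LinearAlgebra.TensorProduct.RightExactness
import HarnessLib

/-!
# Sheafification is monoidal; the associator `(L ⊗ M) ⊗ N ≅ L ⊗ (M ⊗ N)` of `𝒪_X`-modules

The Stacks Project, Tag 01CA (Modules, §17.16): the tensor product of `𝒪_X`-modules is the
sheafification of the presheaf tensor product, "there are functorial isomorphisms
`(ℱ ⊗ 𝒢) ⊗ ℋ = ℱ ⊗ (𝒢 ⊗ ℋ)`", and (proof of Lemma 17.16.1 / 17.16.3) the sheafification does not see the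
difference between a presheaf and its associated sheaf inside a tensor product:
`(𝒢^# ⊗_p ℋ)^# = (𝒢 ⊗_p ℋ)^#`. The tree's `Modules.tensorObj` (`Modules/TensorProduct`) is this
sheafified tensor product and Mathlib (pin) has the full monoidal structure on PRESHEAVES of modules
(`PresheafOfModules.monoidalCategory`, associator `α_`); what was missing ("Not here … the associator
… needs the compatibility of sheafification with the presheaf tensor product", `Modules/TensorProduct`)
is exactly that compatibility, proved here:

* §1 the unit `η_A : A ⟶ A^#` of a presheaf of modules (`sheafifyUnit`; Mathlib's `toSheafify` on
  abelian presheaves), restriction of sections `resP` and its algebra, and the two local properties of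
  `η` unpacked on opens: sections of `A^#` lift locally (`exists_sheafifyUnit_app_eq_nhds(_finset)`),
  sections killed by `η` vanish locally (`exists_resP_eq_zero_nhds(_finset)`);
* §2 **`η_A ⊗ 𝟙_B : A ⊗_p B ⟶ A^# ⊗_p B` is locally surjective** (`isLocallySurjective_whiskerRight_sheafifyUnit`);
* §3 **`η_A ⊗ 𝟙_B` is locally injective** (`isLocallyInjective_whiskerRight_sheafifyUnit`, through
  `exists_resP_eq_zero_of_whiskerRight_eq_zero`): if `∑ η(aᵢ) ⊗ bᵢ = 0` in `A^#(U) ⊗_{𝒪(U)} B(U)`, the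
  vanishing already happens in `N' ⊗ B(U)` for a finitely generated `N' ∋ η(aᵢ)` (tensor products commute
  with filtered colimits: Mathlib `Submodule.FG.exists_rTensor_fg_inclusion_eq`); on a neighbourhood
  `V` the generators of `N'` lift to `A`, so the image of `∑ aᵢ|_V ⊗ bᵢ|_V` in `(im η_V) ⊗ B(V)` vanishes;
  by right exactness of `⊗` (Mathlib `rTensor_exact`) it comes from `(ker η_V) ⊗ B(V)`, whose elements
  vanish locally — no stalks are used;
* §4 hence **sheafification is monoidal**: `(η_A ⊗ 𝟙_B)^# : (A ⊗_p B)^# ⟶ (A^# ⊗_p B)^#` is an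
  isomorphism (`isIso_sheafify_map_whiskerRight_sheafifyUnit`; Mathlib's `W = locally bijective` for
  abelian sheaves and `SheafOfModules.toSheaf` reflecting isomorphisms), and so is `(𝟙_A ⊗ η_B)^#`
  (`isIso_sheafify_map_whiskerLeft_sheafifyUnit`, by the braiding);
* §5 **the associator** `tensorAssoc L M N : (L ⊗ M) ⊗ N ≅ L ⊗ (M ⊗ N)` — Mathlib's presheaf associator
  sheafified, conjugated by the two monoidality isomorphisms — with its defining square
  (`sheafify_map_whiskerRight_tensorAssoc_hom`), the SECTION FORMULAS
  **`α((l ⊗ m) ⊗ n) = l ⊗ (m ⊗ n)`** (`tensorAssoc_hom_app_tmulSection`, elementary tensors `tmulSection`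
  of `Modules/PullbackTensor`) and `tensorAssoc_inv_app_tmulSection`, the naturality of the two
  monoidality morphisms (`sheafify_map_whiskerRight/Left_sheafifyUnit_naturality`) and the
  **NATURALITY OF THE ASSOCIATOR** `((f ⊗ g) ⊗ h) ≫ α = α ≫ (f ⊗ (g ⊗ h))` (`tensorAssoc_naturality`,
  Mathlib's presheaf `associator_naturality` transported through §4).

Everything is proved; no named facts, no instances (no `MonoidalCategory X.Modules` is declared), no
notation. Not here: the pentagon and the triangle/hexagon with the unitors of `Modules/TensorUnitors`
and the braiding of `Modules/TensorBraiding` (each is the corresponding presheaf coherence of Mathlib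
transported through §4 in the same way as `tensorAssoc_naturality`). Use (Hodge programme,
road №4, crux 26512, library item (P2): Mukai's exchange rows rearrange triple tensor products, the
determinant of a tensor product, 0B8M); library only — proves nothing about 26512, №4, HC_AV or HC.

## References

* The Stacks Project, Tag 01CA (Modules, §17.16: tensor product, Lemmas 17.16.1–17.16.4), Tag 007X / 0080
  (sheafification on spaces: locally injective / surjective unit). [StacksProject]
* U. Görtz, T. Wedhorn, *Algebraic Geometry I: Schemes*, 2nd ed. (2020), (7.1), (7.4), (7.4.8). [GortzWedhorn2020]
-/

noncomputable section

-- `TopCat.Presheaf`/`Scheme.Modules` are not reducible (as in Mathlib's `AlgebraicGeometry/Modules/Sheaf.lean`).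
set_option backward.isDefEq.respectTransparency false

open CategoryTheory AlgebraicGeometry Opposite TopologicalSpace MonoidalCategory
open scoped TensorProduct

universe u

namespace Literature.AlgebraicGeometry.Modules

variable {X : Scheme.{u}}

/-! ### §1 The sheafification unit of a presheaf of modules: sections, local lifts, local vanishing -/

section Unit

variable (A : CommRingedPresheafOfModules X)

/-- The sheafification unit `η_A : A ⟶ (A^#)` of a presheaf of `𝒪_X`-modules (underlying presheaf of
the tree's `modulesSheafifyAdjunction`; on abelian presheaves it is Mathlib's `toSheafify`).
[cite: StacksProject, Tag 01CA] -/
abbrev sheafifyUnit : A ⟶ toCommRingedPresheaf ((modulesSheafify X).obj A) :=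
  (modulesSheafifyAdjunction X).unit.app A

/-- On underlying abelian presheaves the unit is Mathlib's `toSheafify`. [folklore] -/
private theorem toPresheaf_map_sheafifyUnit :
    (PresheafOfModules.toPresheaf _).map (sheafifyUnit A) =
      toSheafify (Opens.grothendieckTopology X) A.presheaf := rfl

/-- Restriction of a section of a presheaf of modules to a smaller open. [cite: GortzWedhorn2020, (7.1) and (7.4)] -/
def resP {U V : X.Opens} (h : V ≤ U) (a : A.obj (op U)) : A.obj (op V) :=
  A.map (homOfLE h).op a

/-- Unfolding. [cite: GortzWedhorn2020, (7.1) and (7.4)] -/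
theorem resP_def {U V : X.Opens} (h : V ≤ U) (a : A.obj (op U)) :
    resP A h a = A.map (homOfLE h).op a := rfl

/-- Restriction is additive. [cite: GortzWedhorn2020, (7.1) and (7.4)] -/
@[simp]
theorem resP_zero {U V : X.Opens} (h : V ≤ U) : resP A h (0 : A.obj (op U)) = 0 :=
  map_zero (ConcreteCategory.hom (A.map (homOfLE h).op))

/-- Restriction is additive. [cite: GortzWedhorn2020, (7.1) and (7.4)] -/
theorem resP_add {U V : X.Opens} (h : V ≤ U) (a b : A.obj (op U)) :
    resP A h (a + b) = resP A h a + resP A h b :=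
  map_add (ConcreteCategory.hom (A.map (homOfLE h).op)) a b

/-- Restriction is additive. [cite: GortzWedhorn2020, (7.1) and (7.4)] -/
theorem resP_sub {U V : X.Opens} (h : V ≤ U) (a b : A.obj (op U)) :
    resP A h (a - b) = resP A h a - resP A h b :=
  map_sub (ConcreteCategory.hom (A.map (homOfLE h).op)) a b

/-- Restriction of a finite sum. [cite: GortzWedhorn2020, (7.1) and (7.4)] -/
theorem resP_sum {U V : X.Opens} (h : V ≤ U) {ι : Type*} (t : Finset ι) (a : ι → A.obj (op U)) :
    resP A h (∑ i ∈ t, a i) = ∑ i ∈ t, resP A h (a i) :=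
  map_sum (ConcreteCategory.hom (A.map (homOfLE h).op)) a t

/-- Morphisms of presheaves of modules commute with restriction. [cite: GortzWedhorn2020, (7.1) and (7.4)] -/
theorem app_resP {A A' : CommRingedPresheafOfModules X} (φ : A ⟶ A') {U V : X.Opens} (h : V ≤ U)
    (a : A.obj (op U)) : φ.app (op V) (resP A h a) = resP A' h (φ.app (op U) a) :=
  PresheafOfModules.naturality_apply φ (homOfLE h).op a

/-- Transitivity of restriction. [cite: GortzWedhorn2020, (7.1) and (7.4)] -/
theorem resP_resP {U V W : X.Opens} (h : V ≤ U) (h' : W ≤ V) (a : A.obj (op U)) :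
    resP A h' (resP A h a) = resP A (h'.trans h) a := by
  change (A.presheaf.map (homOfLE h).op ≫ A.presheaf.map (homOfLE h').op) a =
    A.presheaf.map (homOfLE (h'.trans h)).op a
  rw [← Functor.map_comp]
  rfl

/-- Restriction along `le_rfl` is the identity. [cite: GortzWedhorn2020, (7.1) and (7.4)] -/
theorem resP_rfl {U : X.Opens} (a : A.obj (op U)) : resP A (le_refl U) a = a := by
  change A.presheaf.map (homOfLE (le_refl U)).op a = a
  have : (homOfLE (le_refl U)).op = 𝟙 (op U) := rfl
  rw [this, CategoryTheory.Functor.map_id]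
  rfl

/-- The unit commutes with restriction. [folklore] -/
private theorem resP_sheafifyUnit_app {U V : X.Opens} (h : V ≤ U) (a : A.obj (op U)) :
    resP (toCommRingedPresheaf ((modulesSheafify X).obj A)) h ((sheafifyUnit A).app (op U) a) =
      (sheafifyUnit A).app (op V) (resP A h a) :=
  (app_resP (sheafifyUnit A) h a).symm

/-- **Sections of `A^#` lift locally to `A`** (the unit is locally surjective, Mathlib
`Presheaf.IsLocallySurjective J (toSheafify J _)`). [cite: StacksProject, Tag 007X] -/
theorem exists_sheafifyUnit_app_eq_nhds (U : X.Opens)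
    (g : (toCommRingedPresheaf ((modulesSheafify X).obj A)).obj (op U)) (p : X) (hp : p ∈ U) :
    ∃ (V : X.Opens) (h : V ≤ U), p ∈ V ∧ ∃ a : A.obj (op V),
      (sheafifyUnit A).app (op V) a = resP (toCommRingedPresheaf ((modulesSheafify X).obj A)) h g := by
  obtain ⟨V, i, ⟨t, ht⟩, hpV⟩ := Presheaf.imageSieve_mem (Opens.grothendieckTopology X)
    (toSheafify (Opens.grothendieckTopology X) A.presheaf) (U := op U) g p hp
  refine ⟨V, i.le, hpV, t, ?_⟩
  have hi : i = homOfLE i.le := Subsingleton.elim _ _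
  rw [hi] at ht
  exact ht

/-- **A section of `A` killed by the unit vanishes locally** (the unit is locally injective, Mathlib
`Presheaf.IsLocallyInjective J (toSheafify J _)`). [cite: StacksProject, Tag 007X] -/
theorem exists_resP_eq_zero_nhds (U : X.Opens) (a : A.obj (op U)) (ha : (sheafifyUnit A).app (op U) a = 0)
    (p : X) (hp : p ∈ U) : ∃ (V : X.Opens) (h : V ≤ U), p ∈ V ∧ resP A h a = 0 := by
  have h0 : (toSheafify (Opens.grothendieckTopology X) A.presheaf).app (op U) a =
      (toSheafify (Opens.grothendieckTopology X) A.presheaf).app (op U) 0 := by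
    rw [map_zero]; exact ha
  obtain ⟨V, i, hi, hpV⟩ := Presheaf.equalizerSieve_mem (Opens.grothendieckTopology X)
    (toSheafify (Opens.grothendieckTopology X) A.presheaf) a 0 h0 p hp
  refine ⟨V, i.le, hpV, ?_⟩
  have hi' : i = homOfLE i.le := Subsingleton.elim _ _
  rw [hi'] at hi
  change resP A i.le a = resP A i.le 0 at hi
  rw [resP_zero] at hi
  exact hi

/-- Finitely many sections of `A^#` lift to `A` on a common neighbourhood of a point. [cite: StacksProject, Tag 007X] -/
theorem exists_sheafifyUnit_app_eq_nhds_finset (U : X.Opens)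
    (G : Finset ((toCommRingedPresheaf ((modulesSheafify X).obj A)).obj (op U))) (p : X) (hp : p ∈ U) :
    ∃ (V : X.Opens) (h : V ≤ U), p ∈ V ∧ ∀ g ∈ G, ∃ a : A.obj (op V),
      (sheafifyUnit A).app (op V) a = resP (toCommRingedPresheaf ((modulesSheafify X).obj A)) h g := by
  classical
  induction G using Finset.induction_on with
  | empty => exact ⟨U, le_rfl, hp, fun g hg => absurd hg (Finset.notMem_empty g)⟩
  | insert g G hgG ih =>
    obtain ⟨V, hV, hpV, hG⟩ := ih
    obtain ⟨W, hW, hpW, a, ha⟩ := exists_sheafifyUnit_app_eq_nhds A V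
      (resP (toCommRingedPresheaf ((modulesSheafify X).obj A)) hV g) p hpV
    refine ⟨W, hW.trans hV, hpW, fun g' hg' => ?_⟩
    rcases Finset.mem_insert.mp hg' with rfl | hg'G
    · exact ⟨a, by rw [ha, resP_resP]⟩
    · obtain ⟨a', ha'⟩ := hG g' hg'G
      refine ⟨resP A hW a', ?_⟩
      rw [← resP_sheafifyUnit_app, ha', resP_resP]

/-- Finitely many sections of `A` killed by the unit vanish on a common neighbourhood of a point.
[cite: StacksProject, Tag 007X] -/
theorem exists_resP_eq_zero_nhds_finset (U : X.Opens) (G : Finset (A.obj (op U)))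
    (hG : ∀ a ∈ G, (sheafifyUnit A).app (op U) a = 0) (p : X) (hp : p ∈ U) :
    ∃ (V : X.Opens) (h : V ≤ U), p ∈ V ∧ ∀ a ∈ G, resP A h a = 0 := by
  classical
  induction G using Finset.induction_on with
  | empty => exact ⟨U, le_rfl, hp, fun a ha => absurd ha (Finset.notMem_empty a)⟩
  | insert g G hgG ih =>
    obtain ⟨V, hV, hpV, hG'⟩ := ih (fun a ha => hG a (Finset.mem_insert_of_mem ha))
    have hg : (sheafifyUnit A).app (op V) (resP A hV g) = 0 := by
      rw [← resP_sheafifyUnit_app, hG g (Finset.mem_insert_self g G), resP_zero]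
    obtain ⟨W, hW, hpW, hgW⟩ := exists_resP_eq_zero_nhds A V (resP A hV g) hg p hpV
    refine ⟨W, hW.trans hV, hpW, fun a ha => ?_⟩
    rcases Finset.mem_insert.mp ha with rfl | haG
    · rw [← resP_resP A hV hW, hgW]
    · rw [← resP_resP A hV hW, hG' a haG, resP_zero]

end Unit

/-! ### §2 `η_A ⊗ B` is locally surjective -/

section Surj

variable (A B : CommRingedPresheafOfModules X)

/-- Restriction of a pure tensor in a tensor product of presheaves of modules. [cite: GortzWedhorn2020, (7.1) and (7.4)] -/
theorem resP_tmul {U V : X.Opens} (h : V ≤ U) (a : A.obj (op U)) (b : B.obj (op U)) :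
    resP (A ⊗ B) h (a ⊗ₜ[secRing X U] b) = resP A h a ⊗ₜ[secRing X V] resP B h b :=
  PresheafOfModules.Monoidal.tensorObj_map_tmul _ _ _

/-- `(η_A ▷ B)(a ⊗ b) = η(a) ⊗ b`. [folklore] -/
private theorem whiskerRight_app_tmul (U : X.Opens) (a : A.obj (op U)) (b : B.obj (op U)) :
    (sheafifyUnit A ▷ B).app (op U) (a ⊗ₜ[secRing X U] b) =
      (sheafifyUnit A).app (op U) a ⊗ₜ[secRing X U] b :=
  rfl

/-- **`η_A ⊗ 𝟙_B : A ⊗ B ⟶ A^# ⊗ B` is locally surjective**: a section `∑ aᵢ' ⊗ bᵢ` of `A^# ⊗ B`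
lifts locally, since the finitely many `aᵢ'` do. [cite: StacksProject, Tag 01CA (with 007X)] -/
theorem isLocallySurjective_whiskerRight_sheafifyUnit :
    Presheaf.IsLocallySurjective (Opens.grothendieckTopology X)
      ((PresheafOfModules.toPresheaf _).map (sheafifyUnit A ▷ B)) := by
  refine ⟨fun {U} t => ?_⟩
  -- reduce to: for every `t` and `p ∈ U`, a local preimage
  suffices h : ∀ (t : (toCommRingedPresheaf ((modulesSheafify X).obj A) ⊗ B).obj (op U)) (p : X),
      p ∈ U → ∃ (V : X.Opens) (hV : V ≤ U), p ∈ V ∧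
        ∃ s : (A ⊗ B).obj (op V), (sheafifyUnit A ▷ B).app (op V) s =
          resP (toCommRingedPresheaf ((modulesSheafify X).obj A) ⊗ B) hV t by
    intro p hp
    obtain ⟨V, hV, hpV, s, hs⟩ := h t p hp
    exact ⟨V, homOfLE hV, ⟨s, hs⟩, hpV⟩
  intro t
  induction t using TensorProduct.induction_on with
  | zero =>
    intro p hp
    exact ⟨U, le_rfl, hp, 0, by rw [map_zero, resP_zero]⟩
  | tmul g b =>
    intro p hp
    obtain ⟨V, hV, hpV, a, ha⟩ := exists_sheafifyUnit_app_eq_nhds A U g p hp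
    refine ⟨V, hV, hpV, a ⊗ₜ[secRing X V] resP B hV b, ?_⟩
    rw [whiskerRight_app_tmul, ha, resP_tmul]
  | add t₁ t₂ h₁ h₂ =>
    intro p hp
    obtain ⟨V₁, hV₁, hp₁, s₁, hs₁⟩ := h₁ p hp
    obtain ⟨V₂, hV₂, hp₂, s₂, hs₂⟩ := h₂ p hp
    refine ⟨V₁ ⊓ V₂, inf_le_left.trans hV₁, ⟨hp₁, hp₂⟩,
      resP (A ⊗ B) inf_le_left s₁ + resP (A ⊗ B) inf_le_right s₂, ?_⟩
    rw [map_add, resP_add, app_resP, app_resP, hs₁, hs₂, resP_resP, resP_resP]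

end Surj

/-! ### §3 `η_A ⊗ B` is locally injective -/

section Inj

variable (A B : CommRingedPresheafOfModules X)

/-- The underlying presheaf of modules of the sheafification `A^#`. [cite: GortzWedhorn2020, (7.1) and (7.4)] -/
abbrev sheafifyVal : CommRingedPresheafOfModules X := toCommRingedPresheaf ((modulesSheafify X).obj A)

/-- The unit on sections over `U`, as a linear map `A(U) → A^#(U)`. [cite: GortzWedhorn2020, (7.1) and (7.4)] -/
abbrev unitLin (U : X.Opens) : A.obj (op U) →ₗ[secRing X U] (sheafifyVal A).obj (op U) :=
  ((sheafifyUnit A).app (op U)).hom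

/-- Restriction is semilinear: `(r a)|_V = r|_V a|_V`. [cite: GortzWedhorn2020, (7.1) and (7.4)] -/
theorem resP_smul {U V : X.Opens} (h : V ≤ U) (r : secRing X U) (a : A.obj (op U)) :
    resP A h (r • a) = resRing h r • resP A h a :=
  A.map_smul _ r a

/-- A tensor `∑ κⱼ ⊗ βⱼ` with all `κⱼ` killed by the unit vanishes locally (the `κⱼ` vanish on a common
neighbourhood). [cite: StacksProject, Tag 007X] -/
theorem exists_resP_rTensor_subtype_eq_zero_nhds (V : X.Opens)
    (K : Submodule (secRing X V) (A.obj (op V))) (hK : ∀ κ ∈ K, unitLin A V κ = 0)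
    (k : K ⊗[secRing X V] B.obj (op V)) (p : X) (hp : p ∈ V) :
    ∃ (W : X.Opens) (h : W ≤ V), p ∈ W ∧ resP (A ⊗ B) h (K.subtype.rTensor (B.obj (op V)) k) = 0 := by
  induction k using TensorProduct.induction_on with
  | zero => exact ⟨V, le_rfl, hp, by rw [map_zero, resP_zero]⟩
  | tmul κ b =>
    obtain ⟨W, hW, hpW, hκ⟩ := exists_resP_eq_zero_nhds A V κ.1 (hK κ.1 κ.2) p hp
    refine ⟨W, hW, hpW, ?_⟩
    rw [LinearMap.rTensor_tmul, Submodule.subtype_apply, resP_tmul, hκ, TensorProduct.zero_tmul]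
  | add k₁ k₂ h₁ h₂ =>
    obtain ⟨W₁, hW₁, hp₁, e₁⟩ := h₁
    obtain ⟨W₂, hW₂, hp₂, e₂⟩ := h₂
    refine ⟨W₁ ⊓ W₂, inf_le_left.trans hW₁, ⟨hp₁, hp₂⟩, ?_⟩
    rw [map_add, resP_add, ← resP_resP (A ⊗ B) hW₁ inf_le_left, e₁, resP_zero,
      ← resP_resP (A ⊗ B) hW₂ inf_le_right, e₂, resP_zero, add_zero]

set_option maxHeartbeats 800000 in
/-- **`η_A ⊗ 𝟙_B` kills only locally-zero tensors**: if `(η ⊗ 1)(s) = 0` in `A^#(U) ⊗_{𝒪(U)} B(U)` then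
`s` vanishes on a neighbourhood of every point of `U`. Proof: write `s = ∑ aᵢ ⊗ bᵢ`; the vanishing of
`∑ η(aᵢ) ⊗ bᵢ` in `A^#(U) ⊗ B(U)` already happens in `N' ⊗ B(U)` for a finitely generated
`N' ∋ η(aᵢ)` (tensor products commute with filtered colimits, Mathlib
`Submodule.FG.exists_rTensor_fg_inclusion_eq`); on a neighbourhood `V` the generators of `N'` lift to
`A` (local surjectivity of `η`), so over `V` the image of `s` in `(im η_V) ⊗ B(V)` vanishes; by right
exactness of `⊗` (`rTensor_exact`) `s|_V` comes from `(ker η_V) ⊗ B(V)`, whose elements vanish locally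
(local injectivity of `η`). [cite: StacksProject, Tag 01CA (with 007X)] -/
theorem exists_resP_eq_zero_of_whiskerRight_eq_zero (U : X.Opens) (s : (A ⊗ B).obj (op U))
    (hs : (sheafifyUnit A ▷ B).app (op U) s = 0) (p : X) (hp : p ∈ U) :
    ∃ (V : X.Opens) (h : V ≤ U), p ∈ V ∧ resP (A ⊗ B) h s = 0 := by
  classical
  -- (1) a finite representation of `s`
  obtain ⟨S, hS⟩ := TensorProduct.exists_finset (R := secRing X U) (M := A.obj (op U))
    (N := B.obj (op U)) s
  -- (2) the finitely generated submodule `N ∋ η(aᵢ)` and the lift of `(η ⊗ 1)(s)` to `N ⊗ B(U)`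
  let N : Submodule (secRing X U) ((sheafifyVal A).obj (op U)) :=
    Submodule.span _ (Set.range fun i : S => unitLin A U i.1.1)
  have hN : N.FG := Submodule.fg_span (Set.finite_range _)
  have hmem : ∀ i ∈ S, unitLin A U i.1 ∈ N := fun i hi =>
    Submodule.subset_span ⟨⟨i, hi⟩, rfl⟩
  let s' : N ⊗[secRing X U] B.obj (op U) :=
    ∑ i ∈ S.attach, (⟨unitLin A U i.1.1, hmem i.1 i.2⟩ : N) ⊗ₜ[secRing X U] i.1.2
  have hs' : N.subtype.rTensor (B.obj (op U)) s' = N.subtype.rTensor (B.obj (op U)) 0 := by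
    have e : N.subtype.rTensor (B.obj (op U)) s' =
        ∑ i ∈ S, unitLin A U i.1 ⊗ₜ[secRing X U] i.2 := by
      simp only [s', map_sum, LinearMap.rTensor_tmul, Submodule.subtype_apply]
      exact Finset.sum_attach S fun i => unitLin A U i.1 ⊗ₜ[secRing X U] i.2
    have e' : (sheafifyUnit A ▷ B).app (op U) s = ∑ i ∈ S, unitLin A U i.1 ⊗ₜ[secRing X U] i.2 := by
      rw [hS, map_sum]
      rfl
    rw [map_zero, e, ← e', hs]
  obtain ⟨N', hN', hle, hzero⟩ := Submodule.FG.exists_rTensor_fg_inclusion_eq hN hs'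
  rw [map_zero] at hzero
  -- (3) the generators of `N'` lift to `A` on a neighbourhood `V` of `p`
  obtain ⟨G, hG⟩ := hN'
  obtain ⟨V, hV, hpV, hlift⟩ := exists_sheafifyUnit_app_eq_nhds_finset A U G p hp
  -- (4) transport to `V`: `N'|_V ⊆ im η_V`, and the balanced map `N' ⊗ B(U) → (im η_V) ⊗ B(V)`
  have hrange : ∀ n : N', resP (sheafifyVal A) hV (n : (sheafifyVal A).obj (op U)) ∈
      LinearMap.range (unitLin A V) := by
    rintro ⟨n, hn⟩
    rw [← hG] at hn
    refine Submodule.span_induction (p := fun n _ => resP (sheafifyVal A) hV n ∈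
      LinearMap.range (unitLin A V)) ?_ ?_ ?_ ?_ hn
    · intro g hg
      obtain ⟨a, ha⟩ := hlift g (Finset.mem_coe.mp hg)
      exact ⟨a, ha⟩
    · rw [resP_zero]; exact Submodule.zero_mem _
    · intro x y _ _ hx hy
      rw [resP_add]; exact Submodule.add_mem _ hx hy
    · intro r x _ hx
      rw [resP_smul]; exact Submodule.smul_mem _ _ hx
  let c : N' →+ LinearMap.range (unitLin A V) :=
    { toFun := fun n => ⟨resP (sheafifyVal A) hV n, hrange n⟩
      map_zero' := by ext; exact resP_zero _ _
      map_add' := fun x y => by ext; exact resP_add _ _ _ _ }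
  have c_smul : ∀ (r : secRing X U) (n : N'), c (r • n) = resRing hV r • c n := fun r n => by
    ext; exact resP_smul _ _ _ _
  let F : N' →+ B.obj (op U) →+ LinearMap.range (unitLin A V) ⊗[secRing X V] B.obj (op V) :=
    { toFun := fun n =>
        { toFun := fun b => c n ⊗ₜ[secRing X V] resP B hV b
          map_zero' := by
            change c n ⊗ₜ[secRing X V] resP B hV 0 = 0
            rw [resP_zero, TensorProduct.tmul_zero]
          map_add' := fun b b' => by
            change c n ⊗ₜ[secRing X V] resP B hV (b + b') = c n ⊗ₜ[secRing X V] resP B hV b +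
              c n ⊗ₜ[secRing X V] resP B hV b'
            rw [resP_add, TensorProduct.tmul_add] }
      map_zero' := by
        ext b
        change c 0 ⊗ₜ[secRing X V] resP B hV b = 0
        rw [map_zero, TensorProduct.zero_tmul]
      map_add' := fun n n' => by
        ext b
        change c (n + n') ⊗ₜ[secRing X V] resP B hV b = c n ⊗ₜ[secRing X V] resP B hV b +
          c n' ⊗ₜ[secRing X V] resP B hV b
        rw [map_add, TensorProduct.add_tmul] }
  have hF : ∀ (n : N') (b : B.obj (op U)), F n b = c n ⊗ₜ[secRing X V] resP B hV b := fun _ _ => rfl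
  let Λ : N' ⊗[secRing X U] B.obj (op U) →+ LinearMap.range (unitLin A V) ⊗[secRing X V] B.obj (op V) :=
    TensorProduct.liftAddHom F (fun r n b => by
      rw [hF, hF, c_smul, resP_smul, TensorProduct.smul_tmul])
  have hΛtmul : ∀ (n : N') (b : B.obj (op U)), Λ (n ⊗ₜ[secRing X U] b) = c n ⊗ₜ[secRing X V] resP B hV b :=
    fun n b => by rw [TensorProduct.liftAddHom_tmul, hF]
  -- the values of the restricted sections
  have hS' : resP (A ⊗ B) hV s = ∑ i ∈ S.attach, resP A hV i.1.1 ⊗ₜ[secRing X V] resP B hV i.1.2 := by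
    rw [hS, resP_sum, ← Finset.sum_attach S]
    exact Finset.sum_congr rfl fun i _ => resP_tmul A B hV i.1.1 i.1.2
  have lhs : Λ ((N.inclusion hle).rTensor (B.obj (op U)) s') =
      ∑ i ∈ S.attach, c (N.inclusion hle ⟨unitLin A U i.1.1, hmem i.1 i.2⟩) ⊗ₜ[secRing X V]
        resP B hV i.1.2 := by
    simp only [s', map_sum, LinearMap.rTensor_tmul, hΛtmul]
  have rhs : (unitLin A V).rangeRestrict.rTensor (B.obj (op V)) (resP (A ⊗ B) hV s) =
      ∑ i ∈ S.attach, (unitLin A V).rangeRestrict (resP A hV i.1.1) ⊗ₜ[secRing X V] resP B hV i.1.2 := by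
    rw [hS', map_sum]
    exact Finset.sum_congr rfl fun i _ => LinearMap.rTensor_tmul _ _ _ _
  have hΛ : Λ ((N.inclusion hle).rTensor (B.obj (op U)) s') =
      (unitLin A V).rangeRestrict.rTensor (B.obj (op V)) (resP (A ⊗ B) hV s) := by
    rw [lhs, rhs]
    refine Finset.sum_congr rfl fun i _ => ?_
    congr 1
    apply Subtype.ext
    change resP (sheafifyVal A) hV (unitLin A U i.1.1) = unitLin A V (resP A hV i.1.1)
    exact resP_sheafifyUnit_app A hV i.1.1
  rw [hzero, map_zero] at hΛ
  -- (5) right exactness: `s|_V` comes from `(ker η_V) ⊗ B(V)`, hence vanishes locally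
  have hex := rTensor_exact (B.obj (op V)) (LinearMap.exact_subtype_ker_map (unitLin A V).rangeRestrict)
    (LinearMap.surjective_rangeRestrict _)
  obtain ⟨k, hk⟩ := (hex _).mp hΛ.symm
  have hK : ∀ κ ∈ LinearMap.ker (unitLin A V).rangeRestrict, unitLin A V κ = 0 := fun κ hκ => by
    rw [LinearMap.ker_rangeRestrict] at hκ
    exact LinearMap.mem_ker.mp hκ
  obtain ⟨W, hW, hpW, hkW⟩ := exists_resP_rTensor_subtype_eq_zero_nhds A B V _ hK k p hpV
  refine ⟨W, hW.trans hV, hpW, ?_⟩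
  rw [← resP_resP (A ⊗ B) hV hW, ← hk, hkW]

/-- **`η_A ⊗ 𝟙_B : A ⊗ B ⟶ A^# ⊗ B` is locally injective.** [cite: StacksProject, Tag 01CA (with 007X)] -/
theorem isLocallyInjective_whiskerRight_sheafifyUnit :
    Presheaf.IsLocallyInjective (Opens.grothendieckTopology X)
      ((PresheafOfModules.toPresheaf _).map (sheafifyUnit A ▷ B)) := by
  refine ⟨fun {U} x y h => ?_⟩
  intro p hp
  have h0 : (sheafifyUnit A ▷ B).app U (x - y) = 0 := by
    rw [map_sub, sub_eq_zero]
    exact h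
  obtain ⟨V, hV, hpV, hxy⟩ := exists_resP_eq_zero_of_whiskerRight_eq_zero A B U.unop (x - y) h0 p hp
  refine ⟨V, homOfLE hV, ?_, hpV⟩
  change resP (A ⊗ B) hV x = resP (A ⊗ B) hV y
  rw [← sub_eq_zero, ← resP_sub]
  exact hxy

end Inj

/-! ### §4 Sheafification is monoidal: `(A ⊗ B)^# ≅ (A^# ⊗ B)^#`, `(A ⊗ B)^# ≅ (A ⊗ B^#)^#` -/

section Monoidal

variable (A B : CommRingedPresheafOfModules X)

/-- **`(η_A ⊗ 𝟙_B)^# : (A ⊗ B)^# ⟶ (A^# ⊗ B)^#` is an isomorphism** (sheafification is monoidal): the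
underlying morphism of abelian presheaves is locally bijective (§2, §3), hence inverted by
sheafification (Mathlib `GrothendieckTopology.W_of_isLocallyBijective`, `W_iff`), and
`SheafOfModules.toSheaf` reflects isomorphisms. [cite: StacksProject, Tag 01CA] -/
theorem isIso_sheafify_map_whiskerRight_sheafifyUnit :
    IsIso ((modulesSheafify X).map (sheafifyUnit A ▷ B)) := by
  have h₁ := isLocallyInjective_whiskerRight_sheafifyUnit A B
  have h₂ := isLocallySurjective_whiskerRight_sheafifyUnit A B
  have hW := GrothendieckTopology.W_of_isLocallyBijective (Opens.grothendieckTopology X)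
    ((PresheafOfModules.toPresheaf _).map (sheafifyUnit A ▷ B))
  have h₃ : IsIso ((SheafOfModules.toSheaf _).map ((modulesSheafify X).map (sheafifyUnit A ▷ B))) :=
    (GrothendieckTopology.W_iff _ _).mp hW
  have h₄ : IsIso ((Scheme.Modules.toPresheaf X).map ((modulesSheafify X).map (sheafifyUnit A ▷ B))) :=
    show IsIso ((sheafToPresheaf _ _).map
      ((SheafOfModules.toSheaf _).map ((modulesSheafify X).map (sheafifyUnit A ▷ B)))) from inferInstance
  exact isIso_of_reflects_iso _ (Scheme.Modules.toPresheaf X)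

/-- The same on the other side: **`(𝟙_A ⊗ η_B)^#` is an isomorphism** (conjugate by the braiding).
[cite: StacksProject, Tag 01CA] -/
theorem isIso_sheafify_map_whiskerLeft_sheafifyUnit :
    IsIso ((modulesSheafify X).map (A ◁ sheafifyUnit B)) := by
  have h : A ◁ sheafifyUnit B =
      (β_ A B).hom ≫ (sheafifyUnit B ▷ A) ≫ (β_ A (sheafifyVal B)).inv := by
    rw [← Category.assoc, ← BraidedCategory.braiding_naturality_right, Category.assoc, Iso.hom_inv_id,
      Category.comp_id]
  rw [h, Functor.map_comp, Functor.map_comp]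
  haveI := isIso_sheafify_map_whiskerRight_sheafifyUnit B A
  infer_instance

/-- Naturality of the unit under sheafification, on sections: `φ^#(η x) = η(φ x)`. [cite: GortzWedhorn2020, (7.1) and (7.4)] -/
theorem sheafify_map_app_sheafifyUnit {P Q : CommRingedPresheafOfModules X} (φ : P ⟶ Q) (U : X.Opens)
    (x : P.obj (op U)) :
    ((modulesSheafify X).map φ).app U ((sheafifyUnit P).app (op U) x) =
      (sheafifyUnit Q).app (op U) (φ.app (op U) x) := by
  have h := congrArg (fun α => α.app (op U) x) ((modulesSheafifyAdjunction X).unit.naturality φ)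
  simp only [Functor.id_map, Functor.comp_map, PresheafOfModules.comp_app] at h
  exact h.symm

end Monoidal

/-! ### §5 The associator `(L ⊗ M) ⊗ N ≅ L ⊗ (M ⊗ N)` -/

section Associator

variable (L M N : X.Modules)

/-- **The associator `(L ⊗ M) ⊗ N ≅ L ⊗ (M ⊗ N)` of the tensor product of `𝒪_X`-modules**: Mathlib's
associator of presheaves of modules, sheafified, conjugated by the two monoidality isomorphisms
`((L ⊗_p M) ⊗_p N)^# ≅ ((L ⊗ M) ⊗_p N)^# = (L ⊗ M) ⊗ N` and `(L ⊗_p (M ⊗_p N))^# ≅ L ⊗ (M ⊗ N)` of §4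
("`(ℱ ⊗ 𝒢) ⊗ ℋ = ℱ ⊗ (𝒢 ⊗ ℋ)` … functorial isomorphisms", Stacks 01CA). [cite: StacksProject, Tag 01CA (Lemma 17.16.1)] -/
def tensorAssoc : tensorObj (tensorObj L M) N ≅ tensorObj L (tensorObj M N) :=
  haveI := isIso_sheafify_map_whiskerRight_sheafifyUnit (tensorPresheaf L M) (toCommRingedPresheaf N)
  haveI := isIso_sheafify_map_whiskerLeft_sheafifyUnit (toCommRingedPresheaf L) (tensorPresheaf M N)
  (asIso ((modulesSheafify X).map (sheafifyUnit (tensorPresheaf L M) ▷ toCommRingedPresheaf N))).symm ≪≫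
    (modulesSheafify X).mapIso
      (α_ (toCommRingedPresheaf L) (toCommRingedPresheaf M) (toCommRingedPresheaf N)) ≪≫
    asIso ((modulesSheafify X).map (toCommRingedPresheaf L ◁ sheafifyUnit (tensorPresheaf M N)))

/-- The defining relation of the associator: precomposed with the monoidality isomorphism on the left
it is the sheafified presheaf associator followed by the one on the right. [cite: StacksProject, Tag 01CA (Lemma 17.16.1)] -/
theorem sheafify_map_whiskerRight_tensorAssoc_hom :
    (modulesSheafify X).map (sheafifyUnit (tensorPresheaf L M) ▷ toCommRingedPresheaf N) ≫
        (tensorAssoc L M N).hom =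
      (modulesSheafify X).map
          (α_ (toCommRingedPresheaf L) (toCommRingedPresheaf M) (toCommRingedPresheaf N)).hom ≫
        (modulesSheafify X).map (toCommRingedPresheaf L ◁ sheafifyUnit (tensorPresheaf M N)) := by
  haveI := isIso_sheafify_map_whiskerRight_sheafifyUnit (tensorPresheaf L M) (toCommRingedPresheaf N)
  rw [tensorAssoc, Iso.trans_hom, Iso.trans_hom, Iso.symm_hom, asIso_inv, IsIso.hom_inv_id_assoc,
    Functor.mapIso_hom, asIso_hom]

/-- **`α((l ⊗ m) ⊗ n) = l ⊗ (m ⊗ n)`** on elementary tensors. [cite: StacksProject, Tag 01CA (Lemma 17.16.1)] -/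
theorem tensorAssoc_hom_app_tmulSection (U : X.Opens) (l : secMod L U) (m : secMod M U) (n : secMod N U) :
    (tensorAssoc L M N).hom.app U (tmulSection (tensorObj L M) N U (tmulSection L M U l m) n) =
      tmulSection L (tensorObj M N) U l (tmulSection M N U m n) := by
  -- `(l ⊗ m) ⊗ n` is the image of `η((l ⊗ₜ m) ⊗ₜ n)` under the left monoidality isomorphism
  have h₁ : ((modulesSheafify X).map (sheafifyUnit (tensorPresheaf L M) ▷ toCommRingedPresheaf N)).app U
      ((sheafifyUnit (tensorPresheaf L M ⊗ toCommRingedPresheaf N)).app (op U)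
        ((l ⊗ₜ[secRing X U] m) ⊗ₜ[secRing X U] n)) =
      tmulSection (tensorObj L M) N U (tmulSection L M U l m) n :=
    sheafify_map_app_sheafifyUnit _ U _
  have h₂ := congrArg (fun φ : (modulesSheafify X).obj
      (tensorPresheaf L M ⊗ toCommRingedPresheaf N : CommRingedPresheafOfModules X) ⟶
      tensorObj L (tensorObj M N) => φ.app U
    (((sheafifyUnit (tensorPresheaf L M ⊗ toCommRingedPresheaf N)).app (op U)
      ((l ⊗ₜ[secRing X U] m) ⊗ₜ[secRing X U] n) :
        secMod ((modulesSheafify X).obj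
          (tensorPresheaf L M ⊗ toCommRingedPresheaf N : CommRingedPresheafOfModules X)) U)))
    (sheafify_map_whiskerRight_tensorAssoc_hom L M N)
  simp only [Scheme.Modules.Hom.comp_app, CategoryTheory.comp_apply] at h₂
  rw [h₁] at h₂
  refine h₂.trans ?_
  have e₃ : ((modulesSheafify X).map
      (α_ (toCommRingedPresheaf L) (toCommRingedPresheaf M) (toCommRingedPresheaf N)).hom).app U
      (((sheafifyUnit (tensorPresheaf L M ⊗ toCommRingedPresheaf N)).app (op U)
        ((l ⊗ₜ[secRing X U] m) ⊗ₜ[secRing X U] n) :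
          secMod ((modulesSheafify X).obj
            (tensorPresheaf L M ⊗ toCommRingedPresheaf N : CommRingedPresheafOfModules X)) U)) =
      (sheafifyUnit (toCommRingedPresheaf L ⊗ tensorPresheaf M N)).app (op U)
        (l ⊗ₜ[secRing X U] (m ⊗ₜ[secRing X U] n)) :=
    sheafify_map_app_sheafifyUnit _ U _
  have e₄ : ((modulesSheafify X).map (toCommRingedPresheaf L ◁ sheafifyUnit (tensorPresheaf M N))).app U
      (((sheafifyUnit (toCommRingedPresheaf L ⊗ tensorPresheaf M N)).app (op U)
        (l ⊗ₜ[secRing X U] (m ⊗ₜ[secRing X U] n)) :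
          secMod ((modulesSheafify X).obj
            (toCommRingedPresheaf L ⊗ tensorPresheaf M N : CommRingedPresheafOfModules X)) U)) =
      tmulSection L (tensorObj M N) U l (tmulSection M N U m n) :=
    sheafify_map_app_sheafifyUnit _ U _
  exact (congrArg (fun t => ((modulesSheafify X).map
    (toCommRingedPresheaf L ◁ sheafifyUnit (tensorPresheaf M N))).app U t) e₃).trans e₄

/-- `α⁻¹(l ⊗ (m ⊗ n)) = (l ⊗ m) ⊗ n`. [cite: StacksProject, Tag 01CA (Lemma 17.16.1)] -/
theorem tensorAssoc_inv_app_tmulSection (U : X.Opens) (l : secMod L U) (m : secMod M U) (n : secMod N U) :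
    (tensorAssoc L M N).inv.app U (tmulSection L (tensorObj M N) U l (tmulSection M N U m n)) =
      tmulSection (tensorObj L M) N U (tmulSection L M U l m) n := by
  rw [← tensorAssoc_hom_app_tmulSection L M N U l m n, ← CategoryTheory.comp_apply,
    ← Scheme.Modules.Hom.comp_app, Iso.hom_inv_id, Scheme.Modules.Hom.id_app]
  rfl

variable {L M N}

/-- Presheaf level: `(η ⊗ 𝟙) ≫ ((f ⊗ g)^# ⊗ h) = ((f ⊗ g) ⊗ h) ≫ (η ⊗ 𝟙)` (unit naturality).
[cite: StacksProject, Tag 01CA] -/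
private theorem whiskerRight_sheafifyUnit_comp_tensorHom {L' M' N' : X.Modules} (f : L ⟶ L') (g : M ⟶ M')
    (h : N ⟶ N') :
    (sheafifyUnit (tensorPresheaf L M) ▷ toCommRingedPresheaf N) ≫
        (homToCommRingedPresheaf (tensorMap f g) ⊗ₘ homToCommRingedPresheaf h) =
      ((homToCommRingedPresheaf f ⊗ₘ homToCommRingedPresheaf g) ⊗ₘ homToCommRingedPresheaf h) ≫
        (sheafifyUnit (tensorPresheaf L' M') ▷ toCommRingedPresheaf N') := by
  rw [← MonoidalCategory.tensorHom_id, ← MonoidalCategory.tensorHom_id,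
    MonoidalCategory.tensorHom_comp_tensorHom, MonoidalCategory.tensorHom_comp_tensorHom,
    Category.id_comp, Category.comp_id]
  congr 1
  exact ((modulesSheafifyAdjunction X).unit.naturality
    (homToCommRingedPresheaf f ⊗ₘ homToCommRingedPresheaf g : tensorPresheaf L M ⟶ tensorPresheaf L' M')).symm

/-- Presheaf level: `(𝟙 ⊗ η) ≫ (f ⊗ (g ⊗ h)^#) = (f ⊗ (g ⊗ h)) ≫ (𝟙 ⊗ η)`. [cite: StacksProject, Tag 01CA] -/
private theorem whiskerLeft_sheafifyUnit_comp_tensorHom {L' M' N' : X.Modules} (f : L ⟶ L') (g : M ⟶ M')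
    (h : N ⟶ N') :
    (toCommRingedPresheaf L ◁ sheafifyUnit (tensorPresheaf M N)) ≫
        (homToCommRingedPresheaf f ⊗ₘ homToCommRingedPresheaf (tensorMap g h)) =
      (homToCommRingedPresheaf f ⊗ₘ (homToCommRingedPresheaf g ⊗ₘ homToCommRingedPresheaf h)) ≫
        (toCommRingedPresheaf L' ◁ sheafifyUnit (tensorPresheaf M' N')) := by
  rw [← MonoidalCategory.id_tensorHom, ← MonoidalCategory.id_tensorHom,
    MonoidalCategory.tensorHom_comp_tensorHom, MonoidalCategory.tensorHom_comp_tensorHom,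
    Category.id_comp, Category.comp_id]
  congr 1
  exact ((modulesSheafifyAdjunction X).unit.naturality
    (homToCommRingedPresheaf g ⊗ₘ homToCommRingedPresheaf h : tensorPresheaf M N ⟶ tensorPresheaf M' N')).symm

/-- The left monoidality morphism is natural: `((f ⊗ g) ⊗ h)^# ≫ κ = κ ≫ ((f ⊗ g) ⊗ h)`.
[cite: StacksProject, Tag 01CA] -/
theorem sheafify_map_whiskerRight_sheafifyUnit_naturality {L' M' N' : X.Modules} (f : L ⟶ L') (g : M ⟶ M')
    (h : N ⟶ N') :
    (modulesSheafify X).map (((homToCommRingedPresheaf f ⊗ₘ homToCommRingedPresheaf g) ⊗ₘ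
        homToCommRingedPresheaf h :
          (tensorPresheaf L M ⊗ toCommRingedPresheaf N : CommRingedPresheafOfModules X) ⟶
            (tensorPresheaf L' M' ⊗ toCommRingedPresheaf N' : CommRingedPresheafOfModules X))) ≫
      (modulesSheafify X).map (sheafifyUnit (tensorPresheaf L' M') ▷ toCommRingedPresheaf N') =
    (modulesSheafify X).map (sheafifyUnit (tensorPresheaf L M) ▷ toCommRingedPresheaf N) ≫
      tensorMap (tensorMap f g) h :=
  (((modulesSheafify X).map_comp _ _).symm.trans
    (congrArg (fun φ => (modulesSheafify X).map φ)
      (whiskerRight_sheafifyUnit_comp_tensorHom f g h).symm)).trans ((modulesSheafify X).map_comp _ _)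

/-- The right monoidality morphism is natural: `(f ⊗ (g ⊗ h))^# ≫ κ = κ ≫ (f ⊗ (g ⊗ h))`.
[cite: StacksProject, Tag 01CA] -/
theorem sheafify_map_whiskerLeft_sheafifyUnit_naturality {L' M' N' : X.Modules} (f : L ⟶ L') (g : M ⟶ M')
    (h : N ⟶ N') :
    (modulesSheafify X).map ((homToCommRingedPresheaf f ⊗ₘ
        (homToCommRingedPresheaf g ⊗ₘ homToCommRingedPresheaf h) :
          (toCommRingedPresheaf L ⊗ tensorPresheaf M N : CommRingedPresheafOfModules X) ⟶
            (toCommRingedPresheaf L' ⊗ tensorPresheaf M' N' : CommRingedPresheafOfModules X))) ≫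
      (modulesSheafify X).map (toCommRingedPresheaf L' ◁ sheafifyUnit (tensorPresheaf M' N')) =
    (modulesSheafify X).map (toCommRingedPresheaf L ◁ sheafifyUnit (tensorPresheaf M N)) ≫
      tensorMap f (tensorMap g h) :=
  (((modulesSheafify X).map_comp _ _).symm.trans
    (congrArg (fun φ => (modulesSheafify X).map φ)
      (whiskerLeft_sheafifyUnit_comp_tensorHom f g h).symm)).trans ((modulesSheafify X).map_comp _ _)

/-- Sheafified presheaf associator naturality. [cite: StacksProject, Tag 01CA] -/
private theorem sheafify_map_associator_naturality {L' M' N' : X.Modules} (f : L ⟶ L') (g : M ⟶ M')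
    (h : N ⟶ N') :
    (modulesSheafify X).map (((homToCommRingedPresheaf f ⊗ₘ homToCommRingedPresheaf g) ⊗ₘ
        homToCommRingedPresheaf h :
          (tensorPresheaf L M ⊗ toCommRingedPresheaf N : CommRingedPresheafOfModules X) ⟶
            (tensorPresheaf L' M' ⊗ toCommRingedPresheaf N' : CommRingedPresheafOfModules X))) ≫
      (modulesSheafify X).map
        (α_ (toCommRingedPresheaf L') (toCommRingedPresheaf M') (toCommRingedPresheaf N')).hom =
    (modulesSheafify X).map
        (α_ (toCommRingedPresheaf L) (toCommRingedPresheaf M) (toCommRingedPresheaf N)).hom ≫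
      (modulesSheafify X).map ((homToCommRingedPresheaf f ⊗ₘ
        (homToCommRingedPresheaf g ⊗ₘ homToCommRingedPresheaf h) :
          (toCommRingedPresheaf L ⊗ tensorPresheaf M N : CommRingedPresheafOfModules X) ⟶
            (toCommRingedPresheaf L' ⊗ tensorPresheaf M' N' : CommRingedPresheafOfModules X))) :=
  (((modulesSheafify X).map_comp _ _).symm.trans
    (congrArg (fun φ => (modulesSheafify X).map φ)
      (MonoidalCategory.associator_naturality (C := CommRingedPresheafOfModules X)
        (homToCommRingedPresheaf f) (homToCommRingedPresheaf g) (homToCommRingedPresheaf h)))).trans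
    ((modulesSheafify X).map_comp _ _)

/-- **Naturality of the associator**: `((f ⊗ g) ⊗ h) ≫ α = α ≫ (f ⊗ (g ⊗ h))`.
[cite: StacksProject, Tag 01CA (Lemma 17.16.1)] -/
theorem tensorAssoc_naturality {L' M' N' : X.Modules} (f : L ⟶ L') (g : M ⟶ M') (h : N ⟶ N') :
    tensorMap (tensorMap f g) h ≫ (tensorAssoc L' M' N').hom =
      (tensorAssoc L M N).hom ≫ tensorMap f (tensorMap g h) := by
  haveI := isIso_sheafify_map_whiskerRight_sheafifyUnit (tensorPresheaf L M) (toCommRingedPresheaf N)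
  rw [← cancel_epi ((modulesSheafify X).map (sheafifyUnit (tensorPresheaf L M) ▷ toCommRingedPresheaf N))]
  have e₁ := sheafify_map_whiskerRight_sheafifyUnit_naturality f g h
  have e₂ := sheafify_map_whiskerLeft_sheafifyUnit_naturality f g h
  have e₃ := sheafify_map_associator_naturality f g h
  have sq := sheafify_map_whiskerRight_tensorAssoc_hom L M N
  have sq' := sheafify_map_whiskerRight_tensorAssoc_hom L' M' N'
  calc (modulesSheafify X).map (sheafifyUnit (tensorPresheaf L M) ▷ toCommRingedPresheaf N) ≫
        tensorMap (tensorMap f g) h ≫ (tensorAssoc L' M' N').hom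
      = ((modulesSheafify X).map (((homToCommRingedPresheaf f ⊗ₘ homToCommRingedPresheaf g) ⊗ₘ
            homToCommRingedPresheaf h :
              (tensorPresheaf L M ⊗ toCommRingedPresheaf N : CommRingedPresheafOfModules X) ⟶
                (tensorPresheaf L' M' ⊗ toCommRingedPresheaf N' : CommRingedPresheafOfModules X))) ≫
          (modulesSheafify X).map (sheafifyUnit (tensorPresheaf L' M') ▷ toCommRingedPresheaf N')) ≫
          (tensorAssoc L' M' N').hom := by rw [e₁, Category.assoc]
    _ = (modulesSheafify X).map (((homToCommRingedPresheaf f ⊗ₘ homToCommRingedPresheaf g) ⊗ₘ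
            homToCommRingedPresheaf h :
              (tensorPresheaf L M ⊗ toCommRingedPresheaf N : CommRingedPresheafOfModules X) ⟶
                (tensorPresheaf L' M' ⊗ toCommRingedPresheaf N' : CommRingedPresheafOfModules X))) ≫
          (modulesSheafify X).map
            (α_ (toCommRingedPresheaf L') (toCommRingedPresheaf M') (toCommRingedPresheaf N')).hom ≫
          (modulesSheafify X).map (toCommRingedPresheaf L' ◁ sheafifyUnit (tensorPresheaf M' N')) := by
        rw [Category.assoc, sq']
    _ = (modulesSheafify X).map
            (α_ (toCommRingedPresheaf L) (toCommRingedPresheaf M) (toCommRingedPresheaf N)).hom ≫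
          ((modulesSheafify X).map ((homToCommRingedPresheaf f ⊗ₘ
            (homToCommRingedPresheaf g ⊗ₘ homToCommRingedPresheaf h) :
              (toCommRingedPresheaf L ⊗ tensorPresheaf M N : CommRingedPresheafOfModules X) ⟶
                (toCommRingedPresheaf L' ⊗ tensorPresheaf M' N' : CommRingedPresheafOfModules X))) ≫
          (modulesSheafify X).map (toCommRingedPresheaf L' ◁ sheafifyUnit (tensorPresheaf M' N'))) := by
        rw [← Category.assoc, e₃, Category.assoc]
    _ = (modulesSheafify X).map
            (α_ (toCommRingedPresheaf L) (toCommRingedPresheaf M) (toCommRingedPresheaf N)).hom ≫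
          (modulesSheafify X).map (toCommRingedPresheaf L ◁ sheafifyUnit (tensorPresheaf M N)) ≫
          tensorMap f (tensorMap g h) := by rw [e₂]
    _ = (modulesSheafify X).map (sheafifyUnit (tensorPresheaf L M) ▷ toCommRingedPresheaf N) ≫
          (tensorAssoc L M N).hom ≫ tensorMap f (tensorMap g h) := by
        rw [← Category.assoc, ← sq, Category.assoc]

end Associator

end Literature.AlgebraicGeometry.Modules

end
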